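import Literature.NumberTheory.Transcendental.KZFibredRelations
import Literature.NumberTheory.Transcendental.KZDominatedFamily
import Literature.NumberTheory.Transcendental.KZKernelConjectureForms
import Summits.KontsevichZagierPeriods.KontsevichZagierPeriods.Theses.ValuedFieldSpecialisation
import Summits.KontsevichZagierPeriods.KontsevichZagierPeriods.Theorems.ValuedFieldSpecialisationParametricLiftingStrength

/-!
# Route ValuedFieldSpecialisation — crux `ParametricLifting` (stmt-KontsevichZagierPeriods-3498):
THE KERNEL FORM OF THE CRUX

Helper (`--supports`) for item stmt-KontsevichZagierPeriods-3498 (line `registered`, lead c3). The crux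
`ParametricLifting` (PL) is stated for PAIRS of rational representations with equal value. This file
proves its KERNEL FORM, the exact analogue for PL of `kzKernelConjecture_iff_isRational` for the
summit:

* `parametricLifting_iff_kernelForm` — **PL ⇔ KF**, where KF says: every formal combination `x` with
  `KZ.eval x = 0` is congruent modulo `KZ.relations` to the special-fibre class `Σ mᵢ [r₀ᵢ]` of a
  DOMINATED FIBRED RELATION (`Σ mᵢ [Rᵢ] ∈ KZ.fibredRelations`, `KZ.IsDominatedFamily (R i) (r₀ i) (g i)`).
  The passage pair ↦ kernel is the bookkeeping of `KZKernelConjectureForms.lean`: every `x` is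
  `≡ [a] − [b]` modulo moves (`KZ.exists_integralRep_sub_holds`), `a`, `b` are move-equivalent to
  rational-shape representations (`KZ.exists_isRational_equivalent_holds`), and moves preserve values
  (`KZ.relations_le_ker_eval_holds`, `KZ.Equivalent.value_eq_holds`).

Reading (for the planners of this crux). Write `RegRel ⊆ KZ.FormalRep` for "relations + special-fibre
classes of dominated fibred relations" (the classes a REGULARISED move chain can certify). Then, in the
tree: `KZ.relations ⊆ RegRel ⊆ ker KZ.eval` (the second inclusion is the value shadow
`eval_specialFibre_eq_zero`), the complement SF of the crux is `RegRel ⊆ KZ.relations`, the crux PL is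
`ker KZ.eval ⊆ RegRel` (this file), and the summit is `ker KZ.eval = KZ.relations`
(`kzKernelConjecture_iff_isRational`). The two corollaries record this on the kernel side:

* `kzKernelConjecture_of_specialFibre_of_kernelForm` — **KF ∧ SF ⇒ `KZKernelConjecture`** (subtract);
* `kzKernelConjecture_iff_kernelForm_and_specialFibre` — **`KZKernelConjecture` ⇔ KF ∧ SF**, the
  kernel-side twin of `kontsevichZagierPeriods_iff_parametricLifting_and_specialFibre`.

No definition is introduced (KF and SF are written out in the theorem types, in the vocabulary
`KZ.fibredRelations` / `KZ.IsDominatedFamily`, definitionally the clauses inlined in the route file).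

Sources: M. Kontsevich, D. Zagier, *Periods* (2001), §1.2, Conjecture 1; A. Huber, S. Müller-Stach,
*Periods and Nori Motives* (2017), Conj. 13.2.1 / Rem. 13.2.2 (kernel form, "injectivity is the true
issue"). The fibred/dominated vocabulary is this route's (`KZFibredRelations.lean`, `KZDominatedFamily.lean`).
-/

noncomputable section

namespace Summit.KontsevichZagierPeriods.ValuedFieldSpecialisation

open MeasureTheory Set Filter
open scoped Topology
open Literature.NumberTheory.Transcendental
open Summit.KontsevichZagierPeriods.KontsevichZagierPeriods.Theses.ValuedFieldSpecialisation
  (ParametricLifting)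

/-- **`ParametricLifting` ⇔ its kernel form.** PL (for every pair of rational representations with
equal value, `[r] − [r']` is congruent modulo `KZ.relations` to the special-fibre class of a dominated
fibred relation) is equivalent to the same statement for EVERY formal combination `x` with
`KZ.eval x = 0`. (⇐) take `x = [r] − [r']`. (⇒) `x ≡ [a] − [b]` modulo relations
(`KZ.exists_integralRep_sub_holds`), `a ≈ a'`, `b ≈ b'` with `a'`, `b'` of rational shape
(`KZ.exists_isRational_equivalent_holds`), `a'.value = b'.value` by soundness
(`KZ.relations_le_ker_eval_holds`, `KZ.Equivalent.value_eq_holds`); apply PL to `(a', b')` and add the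
three relations. [Kontsevich–Zagier 2001, §1.2 Conjecture 1; Huber–Müller-Stach 2017, Conj. 13.2.1]
[folklore] -/
theorem parametricLifting_iff_kernelForm :
    Summit.KontsevichZagierPeriods.KontsevichZagierPeriods.Theses.ValuedFieldSpecialisation.ParametricLifting ↔
      ∀ x : KZ.FormalRep, KZ.eval x = 0 →
        ∃ (k : ℕ) (d : Fin k → ℕ) (m : Fin k → ℤ) (R : (i : Fin k) → KZ.IntegralRep (d i + 1))
          (r₀ g : (i : Fin k) → KZ.IntegralRep (d i)),
          (∀ i, KZ.IsDominatedFamily (R i) (r₀ i) (g i)) ∧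
          (∑ i, m i • KZ.of (R i)) ∈ KZ.fibredRelations ∧
          (∑ i, m i • KZ.of (r₀ i)) - x ∈ KZ.relations := by
  constructor
  · intro hPL x hx
    -- `x ≡ [a] − [b]` modulo relations
    obtain ⟨n, n', a, b, hab⟩ := KZ.exists_integralRep_sub_holds x
    -- rationalise both endpoints
    obtain ⟨N, a', ha', haa'⟩ := KZ.exists_isRational_equivalent_holds a
    obtain ⟨N', b', hb', hbb'⟩ := KZ.exists_isRational_equivalent_holds b
    -- values agree: `eval x = 0` and moves preserve values
    have hval_ab : a.value = b.value := by
      have h0 : KZ.eval (x - (KZ.of a - KZ.of b)) = 0 := KZ.relations_le_ker_eval_holds hab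
      rw [map_sub, hx, zero_sub, neg_eq_zero, KZ.eval_of_sub_of, sub_eq_zero] at h0
      exact h0
    have hval : a'.value = b'.value := by
      rw [← KZ.Equivalent.value_eq_holds haa', ← KZ.Equivalent.value_eq_holds hbb', hval_ab]
    -- PL for the rational pair `(a', b')`
    obtain ⟨G, hG, k, d, m, R, r₀, g, hdom, rfl, hfib⟩ := hPL a' b' ha' hb' hval
    refine ⟨k, d, m, R, r₀, g, hdom, hG, ?_⟩
    -- `Σ mᵢ[r₀ᵢ] − x = (Σ mᵢ[r₀ᵢ] − ([a'] − [b'])) + (([a'] − [b']) − ([a] − [b])) + (([a] − [b]) − x)`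
    have h1 : (KZ.of a' - KZ.of b') - (KZ.of a - KZ.of b) ∈ KZ.relations := by
      have : (KZ.of a' - KZ.of b') - (KZ.of a - KZ.of b) =
          (KZ.of b - KZ.of b') - (KZ.of a - KZ.of a') := by abel
      rw [this]
      exact KZ.relations.sub_mem hbb' haa'
    have h2 : (KZ.of a - KZ.of b) - x ∈ KZ.relations := by
      have := KZ.relations.neg_mem hab
      rwa [neg_sub] at this
    have h := KZ.relations.add_mem (KZ.relations.add_mem hfib h1) h2
    have heq : (∑ i, m i • KZ.of (r₀ i)) - (KZ.of a' - KZ.of b') +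
        ((KZ.of a' - KZ.of b') - (KZ.of a - KZ.of b)) + ((KZ.of a - KZ.of b) - x) =
        (∑ i, m i • KZ.of (r₀ i)) - x := by abel
    rwa [heq] at h
  · intro hKF n n' r r' _ _ hv
    have hx : KZ.eval (KZ.of r - KZ.of r') = 0 := by
      rw [KZ.eval_of_sub_of, hv, sub_self]
    obtain ⟨k, d, m, R, r₀, g, hdom, hG, hfib⟩ := hKF _ hx
    exact ⟨_, hG, k, d, m, R, r₀, g, hdom, rfl, hfib⟩

/-- **KF ∧ SF ⇒ the kernel conjecture.** If every `x ∈ ker KZ.eval` is congruent modulo relations to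
the special-fibre class of a dominated fibred relation (KF, the kernel form of `ParametricLifting`) and
special-fibre classes of dominated fibred relations are relations (SF, the complement delivered by
`CTConstruction`), then `ker KZ.eval ⊆ KZ.relations`. [Kontsevich–Zagier 2001, §1.2 Conjecture 1;
Huber–Müller-Stach 2017, Conj. 13.2.1] [folklore] -/
theorem kzKernelConjecture_of_specialFibre_of_kernelForm
    (hKF : ∀ x : KZ.FormalRep, KZ.eval x = 0 →
        ∃ (k : ℕ) (d : Fin k → ℕ) (m : Fin k → ℤ) (R : (i : Fin k) → KZ.IntegralRep (d i + 1))
          (r₀ g : (i : Fin k) → KZ.IntegralRep (d i)),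
          (∀ i, KZ.IsDominatedFamily (R i) (r₀ i) (g i)) ∧
          (∑ i, m i • KZ.of (R i)) ∈ KZ.fibredRelations ∧
          (∑ i, m i • KZ.of (r₀ i)) - x ∈ KZ.relations)
    (hSF : ∀ (k : ℕ) (d : Fin k → ℕ) (m : Fin k → ℤ) (R : (i : Fin k) → KZ.IntegralRep (d i + 1))
      (r₀ g : (i : Fin k) → KZ.IntegralRep (d i)), (∀ i, KZ.IsDominatedFamily (R i) (r₀ i) (g i)) →
      (∑ i, m i • KZ.of (R i)) ∈ KZ.fibredRelations → (∑ i, m i • KZ.of (r₀ i)) ∈ KZ.relations) :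
    KZKernelConjecture := by
  intro x hx
  obtain ⟨k, d, m, R, r₀, g, hdom, hG, hfib⟩ := hKF x hx
  have h := KZ.relations.sub_mem (hSF k d m R r₀ g hdom hG) hfib
  rwa [sub_sub_cancel] at h

/-- **The kernel conjecture ⇔ KF ∧ SF** — the kernel-side twin of
`kontsevichZagierPeriods_iff_parametricLifting_and_specialFibre`: `ker KZ.eval = KZ.relations` holds
iff every element of the kernel is regularised-certified (KF ⇔ `ParametricLifting`,
`parametricLifting_iff_kernelForm`) and regularised certificates are honest relations (SF). Both
conjuncts are consequences of the kernel conjecture (`parametricLifting_of_kzKernelConjecture`,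
`specialFibre_of_kzKernelConjecture`). [Kontsevich–Zagier 2001, §1.2 Conjecture 1; Huber–Müller-Stach
2017, Conj. 13.2.1] [folklore] -/
theorem kzKernelConjecture_iff_kernelForm_and_specialFibre :
    KZKernelConjecture ↔
      (∀ x : KZ.FormalRep, KZ.eval x = 0 →
        ∃ (k : ℕ) (d : Fin k → ℕ) (m : Fin k → ℤ) (R : (i : Fin k) → KZ.IntegralRep (d i + 1))
          (r₀ g : (i : Fin k) → KZ.IntegralRep (d i)),
          (∀ i, KZ.IsDominatedFamily (R i) (r₀ i) (g i)) ∧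
          (∑ i, m i • KZ.of (R i)) ∈ KZ.fibredRelations ∧
          (∑ i, m i • KZ.of (r₀ i)) - x ∈ KZ.relations) ∧
      ∀ (k : ℕ) (d : Fin k → ℕ) (m : Fin k → ℤ) (R : (i : Fin k) → KZ.IntegralRep (d i + 1))
        (r₀ g : (i : Fin k) → KZ.IntegralRep (d i)), (∀ i, KZ.IsDominatedFamily (R i) (r₀ i) (g i)) →
        (∑ i, m i • KZ.of (R i)) ∈ KZ.fibredRelations → (∑ i, m i • KZ.of (r₀ i)) ∈ KZ.relations :=
  ⟨fun h => ⟨parametricLifting_iff_kernelForm.mp (parametricLifting_of_kzKernelConjecture h),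
      specialFibre_of_kzKernelConjecture h⟩,
    fun h => kzKernelConjecture_of_specialFibre_of_kernelForm h.1 h.2⟩

end Summit.KontsevichZagierPeriods.ValuedFieldSpecialisation
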